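import Summits.QuantumFields.QCD.Theorems.SpectralDefectExtinctionWindowExtinctionChessboardDeepCount
import Summits.QuantumFields.QCD.Theorems.SpectralDefectExtinctionWindowExtinctionChessboardDeepUnionBound
import Summits.QuantumFields.QCD.Theorems.SpectralDefectExtinctionWindowExtinctionChessboardDeepAsymptotics
import Literature.MathematicalPhysics.QuantumFieldTheory.QCDPhaseQuenched

/-!
# Stub `stub_deep` (S5, deep extinction from flat-block large deviations) of line `chessboard-cold-cells`
(crux `Summit.QuantumFields.QCD.Theses.SpectralDefectExtinction.WindowExtinction`, item stmt-QuantumFields-8964)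

**Deep extinction.**  Given Ky Fan counting (S4b) and the flat-cube dichotomy (S4) as hypotheses: for every
regularisation `reg` of `N_f ≤ 16` flavours whose phase-quenched measures satisfy the flat-block large deviation
`PQFlatLD` (every prescribed set `A` of `(flatLevel/β_k)`-flat spatial unit cubes costs `e^{−7|A|}`), of
sub-Gaussian volume growth and asymptotically scaling, and for every positive mass tuple `m`, the phase-quenched
expected number of REAL eigenvalues of the massless `r = 1` Wilson–Dirac operator below `deepConst/β_k` is
`≤ ε ((2S+1)/(2L_k+1))⁴` on every torus `2S+1 ≥ 2L_k+1`, eventually in `k` (`DeepExtinctAt N_f reg deepConst m`).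

Proof (all at fixed cutoff; the three helper modules carry the weight).
1. *Deterministic count* (`…ChessboardDeepCount`): with `η = deepConst/β_k`, `n = ⌊√(25β_k/2)⌋` (so
   `128 n² η ≤ 1`), Ky Fan turns the real-root count below `η` into twice the number of eigenvalues of the PSD form
   `Re D_W = dirichletForm` below `2η`, and sub-level counting BY SUPPORTS (no IMS partition) bounds the latter by
   `12 (n+1)⁴ · #{flat-rich positions}`: a sub-level vector vanishing on every block `t + {0,…,n}⁴` that holds
   `≥ n⁴/128` lowest corners of `2η`-flat cubes would contradict the dichotomy's support clause.
2. *Union bound* (`…ChessboardDeepUnionBound`): a flat-rich block contains a flat `⌈n⁴/128⌉`-subset, `2η ≤ flatLevel/β_k`,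
   so `PQFlatLD` prices the tilted expectation of the count at `24 (n+1)⁴ (2S+1)⁴ C((n+1)⁴,⌈n⁴/128⌉) e^{−7⌈n⁴/128⌉}`
   (no measurability of the count is needed: `integral_mono_of_nonneg` against measurable hulls of the flat events).
3. *Arithmetic* (`…ChessboardDeepAsymptotics`): `24 (n+1)⁴ C(·) e^{−7⌈n⁴/128⌉} ≤ e^{−n⁴/1024} ≤ e^{−9β_k²/1024}`
   (`n ≥ 100`, `n² ≥ 3β_k`), the volume factor `(2S+1)⁴ = (2L_k+1)⁴ ((2S+1)/(2L_k+1))⁴` costs `e^{β_k²/256}`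
   (`SubGaussianVolume`), and `e^{−5β_k²/1024} ≤ ε` eventually since `β_k → ∞` (`N_f ≤ 16`); the blocks fit,
   `n + 1 ≤ 2S + 1`, because `β_k a_k → 0` while `a_k L_k → ∞`.
-/

noncomputable section

namespace Summit.QuantumFields.QCD.Cruxes.WindowExtinction.ChessboardColdCells

open scoped BigOperators Matrix Classical ComplexOrder
open MeasureTheory Filter Topology Matrix
open Literature.MathematicalPhysics Literature.MathematicalPhysics.QuantumLattice
  Literature.MathematicalPhysics.QuantumFieldTheory Literature.Probability.LatticeModels

/-- **(S5) Deep extinction from flat-block large deviations** (registered stub `stub_deep` of line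
`chessboard-cold-cells`; `= DeepFromFlatStmt` of the skeleton with `KyFanCounting` and `FlatCubeDichotomy`
spelled out): Ky Fan counting → the flat-cube dichotomy → for every regularisation of `N_f ≤ 16` flavours with the
phase-quenched flat-block large deviation, sub-Gaussian volume growth and asymptotic scaling, and every positive
mass tuple, the deep real modes of `D_W(U,0,1)` (below `deepConst/β_k`) are EXTINCT in the crux's normalisation. -/
theorem stub_deep :
    (∀ (n : Type) [Fintype n] [DecidableEq n] (D : Matrix n n ℂ) (η : ℝ), (D + Dᴴ).PosSemidef →
      (D.charpoly.roots.countP (fun z : ℂ => z.re < η) : ℝ) ≤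
        2 * (((1 / 2 : ℂ) • (D + Dᴴ)).charpoly.roots.countP (fun z : ℂ => z.re < 2 * η) : ℝ)) →
    (∀ (L : ℕ) [NeZero L] (U : GaugeConfig 4 L SU3) (ψ : QuarkIdx L → ℂ) (lam : ℝ) (n : ℕ),
      ψ ≠ 0 → 0 < lam → 1 ≤ n → n + 1 ≤ L → 64 * (n : ℝ) ^ 2 * lam ≤ 1 →
      dirichletForm U ψ ≤ lam * ∑ i, ‖ψ i‖ ^ 2 →
        ∃ t : TorusSite 4 L,
          (n : ℝ) ^ 4 / 128 ≤
            ((Finset.univ.filter fun s : Fin 4 → Fin (n + 1) =>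
                CubeFlat U (t + fun μ => ((s μ : ℕ) : ZMod L)) lam).card : ℝ) ∧
          ∃ (s : Fin 4 → Fin (n + 1)) (a : Fin 3) (α : Fin 4),
            ψ (t + (fun μ => ((s μ : ℕ) : ZMod L)), a, α) ≠ 0) →
    ∀ (Nf : ℕ) (reg : QCDRegularisation Nf), Nf ≤ 16 → PQFlatLD Nf reg →
      SubGaussianVolume reg → (reg.scheme 0 0 0).HasAsymptoticScaling → ∀ m : Fin Nf → ℝ, (∀ f, 0 < m f) →
        DeepExtinctAt Nf reg deepConst m := by
  intro hKF hDich Nf reg hNf hPQ hV hAS m hm ε hε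
  -- eventual facts along the regularisation
  have hβtop : Tendsto reg.β atTop atTop := deep_tendsto_beta_atTop hNf (reg.scheme 0 0 0) hAS
  have E1 := hPQ m hm
  have E2 : ∀ᶠ k in atTop, (817 : ℝ) ≤ reg.β k := hβtop.eventually_ge_atTop _
  have E3 : ∀ᶠ k in atTop, 25 / 2 * reg.β k ≤ reg.L k :=
    deep_eventually_const_mul_beta_le_L reg hAS (by norm_num)
  have E4 : ∀ᶠ k in atTop, ((2 * reg.L k + 1 : ℕ) : ℝ) ^ 4 ≤ Real.exp (1 / 256 * reg.β k ^ 2) :=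
    hV (1 / 256) (by norm_num)
  have E5 : ∀ᶠ k in atTop, Real.exp (reg.β k ^ 2 * (-(5 / 1024))) ≤ ε := by
    have h1 : Tendsto (fun k => reg.β k ^ 2 * (-(5 / 1024) : ℝ)) atTop atBot :=
      ((tendsto_pow_atTop two_ne_zero).comp hβtop).atTop_mul_const_of_neg (by norm_num)
    have h2 := Real.tendsto_exp_atBot.comp h1
    filter_upwards [h2.eventually (Iic_mem_nhds hε)] with k hk
    exact hk
  filter_upwards [E1, E2, E3, E4, E5] with k h1 h2 h3 h4 h5 S hS
  -- the constants at step `k`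
  have hβ1 : (1 : ℝ) ≤ reg.β k := by linarith
  have hβ0 : (0 : ℝ) < reg.β k := by linarith
  set n : ℕ := ⌊Real.sqrt (25 / 2 * reg.β k)⌋₊ with hn_def
  have hn100 : 100 ≤ n := deep_le_blockSide 100 (by norm_num; linarith)
  have hn1 : 1 ≤ n := le_trans (by norm_num) hn100
  have hnsq : (n : ℝ) ^ 2 ≤ 25 / 2 * reg.β k := deep_blockSide_sq_le hβ0.le
  have hn3 : 3 * reg.β k ≤ (n : ℝ) ^ 2 := deep_three_mul_le_blockSide_sq hβ1
  have hnle : (n : ℝ) ≤ 25 / 2 * reg.β k := deep_blockSide_le hβ1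
  have hnL : n + 1 ≤ 2 * S + 1 := by
    have hS' : (reg.L k : ℝ) ≤ S := by exact_mod_cast hS
    have h : (n : ℝ) ≤ S := hnle.trans (h3.trans hS')
    have h' : n ≤ S := by exact_mod_cast h
    omega
  set η : ℝ := deepConst / reg.β k with hη_def
  have hη : 0 < η := div_pos deepConst_pos hβ0
  have hsmall : 128 * (n : ℝ) ^ 2 * η ≤ 1 := by
    have : 128 * (n : ℝ) ^ 2 * η = (n : ℝ) ^ 2 / (25 / 2 * reg.β k) := by
      rw [hη_def, deepConst]
      field_simp
      ring
    rw [this, div_le_one (by positivity)]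
    exact hnsq
  have hlamθ : 2 * η ≤ flatLevel / reg.β k := by
    rw [hη_def, deepConst, flatLevel, show (2 : ℝ) * (1 / 1600 / reg.β k) = (1 / 800) / reg.β k by ring]
    gcongr
    norm_num
  -- the deterministic count bound and the union bound on the torus of side `2S+1`
  have hF : ∀ U : GaugeConfig 4 (2 * S + 1) SU3,
      ((wilsonDirac (fundamentalRep (Fin 3)) U 0 1).charpoly.roots.countP
          (fun z : ℂ => z.im = 0 ∧ z.re < η) : ℝ) ≤
        24 * ((n : ℝ) + 1) ^ 4 *
          ((Finset.univ.filter fun t : TorusSite 4 (2 * S + 1) => (n : ℝ) ^ 4 / 128 ≤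
            ((Finset.univ.filter fun s : Fin 4 → Fin (n + 1) =>
              CubeFlat U (t + fun μ => ((s μ : ℕ) : ZMod (2 * S + 1))) (2 * η)).card : ℝ)).card : ℝ) :=
    fun U => realCount_le_of_kyFan_dichotomy hKF hDich (2 * S + 1) U η n hη hn1 hnL hsmall
  have hmain := deep_weightedIntegral_le_of_flatLD (2 * S + 1)
    (wilsonMeasure (d := 4) (L := 2 * S + 1) (fundamentalRep (Fin 3)) (reg.β k))
    (fun U => ∏ f : Fin Nf, ‖fermionDet (wilsonDirac (fundamentalRep (Fin 3)) U
      (reg.mcrit k + reg.a k * m f / reg.Zm k) 1)‖)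
    (fun U => Finset.prod_nonneg fun f _ => norm_nonneg _) (flatLevel / reg.β k) (2 * η) hlamθ n hnL 7
    (h1 S hS)
    (fun U => ((wilsonDirac (fundamentalRep (Fin 3)) U 0 1).charpoly.roots.countP
      (fun z : ℂ => z.im = 0 ∧ z.re < η) : ℝ))
    (fun U => Nat.cast_nonneg _) (24 * ((n : ℝ) + 1) ^ 4) (by positivity) hF
  -- the numerics
  have hent := deep_entropy_bound n hn100
  have hy : 9 * reg.β k ^ 2 ≤ (n : ℝ) ^ 4 := by nlinarith [hn3]
  have hchain : 24 * ((n : ℝ) + 1) ^ 4 * (((2 * S + 1 : ℕ) : ℝ)) ^ 4 *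
      ((((n + 1) ^ 4).choose ⌈(n : ℝ) ^ 4 / 128⌉₊ : ℕ) : ℝ) *
        Real.exp (-7 * (⌈(n : ℝ) ^ 4 / 128⌉₊ : ℕ)) ≤
      ε * ((2 * S + 1 : ℝ) / (2 * reg.L k + 1)) ^ 4 := by
    have hL0 : (0 : ℝ) < 2 * reg.L k + 1 := by positivity
    have hVol : (2 * (S : ℝ) + 1) ^ 4 =
        (2 * (reg.L k : ℝ) + 1) ^ 4 * ((2 * S + 1 : ℝ) / (2 * reg.L k + 1)) ^ 4 := by
      rw [div_pow, mul_div_cancel₀ _ (pow_ne_zero 4 hL0.ne')]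
    have h4' : (2 * (reg.L k : ℝ) + 1) ^ 4 ≤ Real.exp (1 / 256 * reg.β k ^ 2) := by
      push_cast at h4
      exact h4
    calc 24 * ((n : ℝ) + 1) ^ 4 * (((2 * S + 1 : ℕ) : ℝ)) ^ 4 *
          ((((n + 1) ^ 4).choose ⌈(n : ℝ) ^ 4 / 128⌉₊ : ℕ) : ℝ) * Real.exp (-7 * (⌈(n : ℝ) ^ 4 / 128⌉₊ : ℕ))
        = (24 * ((n : ℝ) + 1) ^ 4 * ((((n + 1) ^ 4).choose ⌈(n : ℝ) ^ 4 / 128⌉₊ : ℕ) : ℝ) *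
            Real.exp (-7 * (⌈(n : ℝ) ^ 4 / 128⌉₊ : ℕ))) * (2 * (S : ℝ) + 1) ^ 4 := by
          push_cast; ring
      _ ≤ Real.exp (-(n : ℝ) ^ 4 / 1024) * (2 * (S : ℝ) + 1) ^ 4 := by gcongr
      _ ≤ Real.exp (-(9 / 1024) * reg.β k ^ 2) * (2 * (S : ℝ) + 1) ^ 4 := by
          gcongr
          linarith
      _ = Real.exp (-(9 / 1024) * reg.β k ^ 2) * (2 * (reg.L k : ℝ) + 1) ^ 4 *
            ((2 * S + 1 : ℝ) / (2 * reg.L k + 1)) ^ 4 := by rw [hVol]; ring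
      _ ≤ Real.exp (-(9 / 1024) * reg.β k ^ 2) * Real.exp (1 / 256 * reg.β k ^ 2) *
            ((2 * S + 1 : ℝ) / (2 * reg.L k + 1)) ^ 4 := by gcongr
      _ = Real.exp (reg.β k ^ 2 * (-(5 / 1024))) * ((2 * S + 1 : ℝ) / (2 * reg.L k + 1)) ^ 4 := by
          rw [← Real.exp_add]
          congr 2
          ring
      _ ≤ ε * ((2 * S + 1 : ℝ) / (2 * reg.L k + 1)) ^ 4 := by gcongr
  exact hmain.trans hchain

end Summit.QuantumFields.QCD.Cruxes.WindowExtinction.ChessboardColdCells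

end
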